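import Summits.CriticalPhenomena.PercolationContinuityZ3.Theses.PercLowPointHalfSpace
import Summits.CriticalPhenomena.PercolationContinuityZ3.Theorems.QuantitativeBGN.Negative.LoadBearing
import Summits.CriticalPhenomena.PercolationContinuityZ3.Theorems.BoundaryTwoArmDecay.Negative.OneArmLowerBound
import Summits.CriticalPhenomena.PercolationContinuityZ3.Theorems.BoundaryTwoArmDecay.Negative.LoadBearing
import Summits.CriticalPhenomena.PercolationContinuityZ3.Theorems.PercLowPointHalfSpaceBoundaryTwoArmDecayStubDecoupling
import Literature.Probability.Percolation.LatticeSymmetry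
import Literature.Probability.Percolation.RSW

/-!
# Crux `PercLowPointHalfSpace.BoundaryTwoArmDecay` (stmt-CriticalPhenomena-0911), line `Sketch` — stub `stub_baseline`

Helper file for the crux skeleton `Cruxes/BoundaryTwoArmDecay/Lines/Sketch.lean` (line
`exploration-decoupled-avoidance-split`, lead prover-line-stmt-CriticalPhenomena-0911-0). Proves EXACTLY the
registered stub signature `stub_baseline`; lands with `--supports stmt-CriticalPhenomena-0911`. No new
definition: the vocabulary is the landed one (`Negative.H`, `Negative.e`, `Negative.μ`, `Negative.far` of
`BoundaryTwoArmDecay/Negative/OneArmLowerBound.lean`, `QuantitativeBGN.Negative.armH`).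

## The statement (the `λ₀ = 0` end of the avoidance split)

With `P = P_{p_c(ℤ³)}`, `ℍ = {x | 0 ≤ x 0}`, `e = (0,1,0) = Pi.single 1 1`, `A(ω) = C_ℍ(0) = {v | 0 ⟷ v in ℍ}`,
`arm_ℍ(0,r) = {0 ⟷ some y with ‖y‖∞ ≥ r, in ℍ}` (`armH r`) and the AVOIDING arm
`avoidArm r ω = {ω' | e ⟷ some y with ‖y - e‖∞ ≥ r, in ℍ ∖ A(ω)}`:

  `∫ 1{arm_ℍ(0,r)}(ω) · P(avoidArm r ω) dP(ω) ≤ P(arm_ℍ(0,r))²`   (`r ≥ 1`; the guard is not used).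

Together with the landed `stub_decoupling` (`P(E r) ≤` the left side) this is the BK-type bound
`P(E r) ≤ P(arm_ℍ(0,r))²` for the crux event — rigorously a₂ ≥ 2a₁ — obtained here WITHOUT the BK inequality:
removing the explored cluster only shrinks the domain (`openConnIn_mono`, Grimmett 1999 §1.6), so
`P(avoidArm r ω) ≤ P(arm_ℍ(e,r))` for every `ω`, and `P(arm_ℍ(e,r)) = P(arm_ℍ(0,r))` by the horizontal translation
`x ↦ x + e`, which preserves `ℍ` and `P_p` (`real_openCrossing_shift`, Grimmett 1999 §1.6). The research stub
`stub_deficiency` of the line asks for the same left side with an extra factor `C r^{-4/5}`.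
-/

noncomputable section

namespace Summit.CriticalPhenomena.PercolationContinuityZ3.Theorems.BoundaryTwoArmDecay

open MeasureTheory
open scoped ENNReal
open Literature.Probability.Percolation Literature.Probability.LatticeModels
open Summit.CriticalPhenomena.PercolationContinuityZ3.Theorems.QuantitativeBGN.Negative (armH measurableSet_armH)

namespace StubBaseline

open Negative (H e μ far)

/-- Domain monotonicity: the avoiding arm of `e` (inside `ℍ ∖ C_ℍ(0)[ω]`) implies the arm of `e` in the whole
half-space. -/
theorem avoidArm_subset_armE (r : ℕ) (ω : BondConfig (Site 3)) :
    {ω' : BondConfig (Site 3) | ∃ y : Site 3, (∃ i : Fin 3, (r : ℤ) ≤ |y i - e i|) ∧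
        ω' ∈ openConnIn (H \ {v | ω ∈ openConnIn H 0 v}) e y} ⊆
      {ω' | ∃ y : Site 3, (∃ i : Fin 3, (r : ℤ) ≤ |y i - e i|) ∧ ω' ∈ openConnIn H e y} := by
  rintro ω' ⟨y, hy, hω'⟩
  exact ⟨y, hy, openConnIn_mono Set.sdiff_subset _ _ hω'⟩

/-- `arm_ℍ(0,r)` as an open crossing event: `{0} ⟷ far r` in `ℍ`. -/
theorem armH_eq_openCrossing (r : ℕ) : armH r = openCrossing H {0} (far r) := by
  ext ω
  simp only [armH, far, mem_openCrossing_iff, Set.mem_singleton_iff, exists_eq_left, Set.mem_setOf_eq]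

/-- `arm_ℍ(e,r)` is the translate by `e` of the crossing event `{0} ⟷ far r` in `ℍ` (`ℍ + e = ℍ` as `e 0 = 0`). -/
theorem armE_eq_openCrossing_shift (r : ℕ) :
    {ω' : BondConfig (Site 3) | ∃ y : Site 3, (∃ i : Fin 3, (r : ℤ) ≤ |y i - e i|) ∧ ω' ∈ openConnIn H e y} =
      openCrossing ((· + e) '' H) ((· + e) '' {0}) ((· + e) '' far r) := by
  have hH : ((· + e) '' H : Set (Site 3)) = H := by
    ext y
    simp only [Set.mem_image, Set.mem_setOf_eq]
    constructor
    · rintro ⟨z, hz, rfl⟩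
      simpa [e] using hz
    · intro hy
      exact ⟨y - e, by simpa [e] using hy, sub_add_cancel y e⟩
  have h0 : ((· + e) '' {0} : Set (Site 3)) = {e} := by
    rw [Set.image_singleton, zero_add]
  have hfar : ((· + e) '' far r : Set (Site 3)) = {y | ∃ i : Fin 3, (r : ℤ) ≤ |y i - e i|} := by
    ext y
    simp only [far, Set.mem_image, Set.mem_setOf_eq]
    constructor
    · rintro ⟨z, ⟨i, hi⟩, rfl⟩
      exact ⟨i, by simpa using hi⟩
    · rintro ⟨i, hi⟩
      exact ⟨y - e, ⟨i, by simpa using hi⟩, sub_add_cancel y e⟩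
  rw [hH, h0, hfar]
  ext ω
  simp only [mem_openCrossing_iff, Set.mem_singleton_iff, exists_eq_left, Set.mem_setOf_eq]

/-- **Shift invariance**: `P(arm_ℍ(e,r)) = P(arm_ℍ(0,r))` (translation by `e` preserves `ℍ` and `P_{p_c}`). -/
theorem measure_armE_eq (r : ℕ) :
    μ {ω' : BondConfig (Site 3) | ∃ y : Site 3, (∃ i : Fin 3, (r : ℤ) ≤ |y i - e i|) ∧ ω' ∈ openConnIn H e y} =
      μ (armH r) := by
  have hreal : μ.real {ω' : BondConfig (Site 3) | ∃ y : Site 3, (∃ i : Fin 3, (r : ℤ) ≤ |y i - e i|) ∧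
      ω' ∈ openConnIn H e y} = μ.real (armH r) := by
    rw [armE_eq_openCrossing_shift, armH_eq_openCrossing]
    exact real_openCrossing_shift (criticalProbI 3) e H {0} (far r)
  exact (ENNReal.toReal_eq_toReal_iff' (measure_ne_top _ _) (measure_ne_top _ _)).1 hreal

/-- **The baseline bound**: `∫ 1{arm_ℍ(0,r)}(ω) P(avoidArm r ω) dP ≤ P(arm_ℍ(0,r))²`. -/
theorem lintegral_avoidArm_le (r : ℕ) :
    ∫⁻ ω, (armH r).indicator (fun _ => (1 : ℝ≥0∞)) ω *
        μ {ω' : BondConfig (Site 3) | ∃ y : Site 3, (∃ i : Fin 3, (r : ℤ) ≤ |y i - e i|) ∧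
          ω' ∈ openConnIn (H \ {v | ω ∈ openConnIn H 0 v}) e y} ∂μ ≤ μ (armH r) ^ 2 := by
  have hmeas : Measurable fun ω => (armH r).indicator (fun _ => (1 : ℝ≥0∞)) ω :=
    measurable_const.indicator (measurableSet_armH r)
  calc ∫⁻ ω, (armH r).indicator (fun _ => (1 : ℝ≥0∞)) ω *
        μ {ω' : BondConfig (Site 3) | ∃ y : Site 3, (∃ i : Fin 3, (r : ℤ) ≤ |y i - e i|) ∧
          ω' ∈ openConnIn (H \ {v | ω ∈ openConnIn H 0 v}) e y} ∂μ
      ≤ ∫⁻ ω, (armH r).indicator (fun _ => (1 : ℝ≥0∞)) ω *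
          μ {ω' : BondConfig (Site 3) | ∃ y : Site 3, (∃ i : Fin 3, (r : ℤ) ≤ |y i - e i|) ∧
            ω' ∈ openConnIn H e y} ∂μ := by
        refine lintegral_mono fun ω => ?_
        exact mul_le_mul' le_rfl (measure_mono (avoidArm_subset_armE r ω))
    _ = (∫⁻ ω, (armH r).indicator (fun _ => (1 : ℝ≥0∞)) ω ∂μ) *
          μ {ω' : BondConfig (Site 3) | ∃ y : Site 3, (∃ i : Fin 3, (r : ℤ) ≤ |y i - e i|) ∧
            ω' ∈ openConnIn H e y} :=
        lintegral_mul_const _ hmeas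
    _ = μ (armH r) * μ (armH r) := by
        rw [lintegral_indicator_const (measurableSet_armH r), one_mul, measure_armE_eq]
    _ = μ (armH r) ^ 2 := (sq _).symm

end StubBaseline

/-- **Registered stub `stub_baseline`** of the skeleton `Cruxes/BoundaryTwoArmDecay/Lines/Sketch.lean` (the `λ₀ = 0`
end of the avoidance split): at `p_c(ℤ³)`, for `r ≥ 1`,
`∫ 1{arm_ℍ(0,r)}(ω) · P({ω' | e ⟷ distance r in ℍ ∖ C_ℍ(0)[ω]}) dP(ω) ≤ P(arm_ℍ(0,r))²`.
Proof: domain monotonicity and translation by `e` (`StubBaseline.lintegral_avoidArm_le`); the guard `1 ≤ r` is unused. -/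
theorem stub_baseline :
    ∀ r : ℕ, 1 ≤ r →
      ∫⁻ ω, {ω : BondConfig (Site 3) | ∃ y : Site 3, (∃ i : Fin 3, (r : ℤ) ≤ |y i|) ∧
                ω ∈ openConnIn {x : Site 3 | 0 ≤ x 0} 0 y}.indicator (fun _ => (1 : ℝ≥0∞)) ω *
            (bondPercolation (zdGraph 3) (criticalProbI 3))
              {ω' | ∃ y : Site 3, (∃ i : Fin 3, (r : ℤ) ≤ |y i - (Pi.single 1 1 : Site 3) i|) ∧
                ω' ∈ openConnIn ({x : Site 3 | 0 ≤ x 0} \ {v | ω ∈ openConnIn {x : Site 3 | 0 ≤ x 0} 0 v})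
                  (Pi.single 1 1 : Site 3) y}
        ∂(bondPercolation (zdGraph 3) (criticalProbI 3)) ≤
      (bondPercolation (zdGraph 3) (criticalProbI 3))
          {ω | ∃ y : Site 3, (∃ i : Fin 3, (r : ℤ) ≤ |y i|) ∧
            ω ∈ openConnIn {x : Site 3 | 0 ≤ x 0} 0 y} ^ 2 :=
  fun r _ => StubBaseline.lintegral_avoidArm_le r

/-! ### Appended (lead, after `stub_decoupling` p90994 and `stub_baseline` p91688 landed): the certified BK-type bound -/

/-- **BK-type bound for the crux event, certified (a₂ ≥ 2a₁).** At `p_c(ℤ³)`, for every `r ≥ 1`,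
`P(arm_ℍ(0,r) ∧ arm_ℍ(e,r) ∧ 0 ↮_ℍ e) ≤ P(arm_ℍ(0,r))²` — the two landed stubs of line `Sketch` composed
(`stub_decoupling`: the crux probability is at most the deficiency integral; `stub_baseline`: the integral is at
most `P(arm_ℍ(0,r))²`). `Negative.E r` is the verbatim crux event (`Negative.boundaryTwoArmDecay_iff`), `armH r` the
verbatim event of item C. This is the first UPPER bound on the crux event in the tree; the crux asks for the power
gain `r^{-(5/2+κ)}` versus `P(arm_ℍ(0,r))² ≳ r^{-4}` (`Negative.halfSpaceArm_ge`). -/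
theorem twoArm_le_armH_sq {r : ℕ} (hr : 1 ≤ r) : Negative.μ (Negative.E r) ≤ Negative.μ (armH r) ^ 2 :=
  (stub_decoupling r hr).trans (stub_baseline r hr)

/-- Real-valued form of `twoArm_le_armH_sq`: `P(E r) ≤ P(arm_ℍ(0,r))²` for `r ≥ 1`. -/
theorem real_twoArm_le_armH_sq {r : ℕ} (hr : 1 ≤ r) :
    Negative.μ.real (Negative.E r) ≤ Negative.μ.real (armH r) ^ 2 := by
  have hne : Negative.μ (armH r) ^ 2 ≠ ∞ := ENNReal.pow_ne_top (measure_ne_top _ _)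
  have h := (ENNReal.toReal_le_toReal (measure_ne_top _ _) hne).2 (twoArm_le_armH_sq hr)
  rwa [ENNReal.toReal_pow] at h

/-- **a₂ ≥ 2a₁**: a boundary one-arm bound `P(arm_ℍ(0,r)) ≤ C r^{-a}` (`r ≥ 1`; e.g. item C with its exponent)
gives the two-arm bound `P(E r) ≤ C² r^{-2a}` for the crux event. With the numerical `a = x_s ≈ 0.975` this is the
BK value `1.95 < 5/2` recorded in the item's why-might-fail line; the line's open stubs ask for the gain beyond it. -/
theorem real_twoArm_le_of_oneArm {a C : ℝ}
    (h : ∀ r : ℕ, 1 ≤ r → Negative.μ.real (armH r) ≤ C * (r : ℝ) ^ (-a)) {r : ℕ} (hr : 1 ≤ r) :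
    Negative.μ.real (Negative.E r) ≤ C ^ 2 * (r : ℝ) ^ (-(2 * a)) := by
  have hr0 : (0 : ℝ) < r := by exact_mod_cast hr
  have hP0 : 0 ≤ Negative.μ.real (armH r) := measureReal_nonneg
  have hsq : Negative.μ.real (armH r) ^ 2 ≤ (C * (r : ℝ) ^ (-a)) ^ 2 := pow_le_pow_left₀ hP0 (h r hr) 2
  have hexp : (C * (r : ℝ) ^ (-a)) ^ 2 = C ^ 2 * (r : ℝ) ^ (-(2 * a)) := by
    rw [mul_pow, ← Real.rpow_natCast ((r : ℝ) ^ (-a)), ← Real.rpow_mul hr0.le]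
    congr 2; push_cast; ring
  exact (real_twoArm_le_armH_sq hr).trans (hsq.trans_eq hexp)

end Summit.CriticalPhenomena.PercolationContinuityZ3.Theorems.BoundaryTwoArmDecay

end
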